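import Literature.NumberTheory.GaloisCohomology.PoitouTateRestrictedShaDualOfReadout
import HarnessLib

/-!
# The `S`-restricted `Ш`-pairing from a READOUT SKELETON (finite `S`): definition, perfectness, naturality
# — the route-independent interface of the lane's last brick (Milne I Thm. 4.10 (a))

Topic `NumberTheory/GaloisCohomology`; namespace `Literature.NumberTheory.GaloisCohomology.ShaReadout`.
Definitions WITH BODIES (`ShaReadout.shaLift`, **`ShaReadout.pairing`**) and theorems; no named fact,
no `sorry`, no instance, no notation.  Lane «PT-Ш-S-TC» of cell `bsd-eis` (crux `GoodLatticeBDPValue`),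
bricks D5a/D5b in SKELETON form.

WHY A SKELETON.  On the presentation road (chl-p2; `PoitouTateRestrictedShaReadoutRoad.lean` is its
`S`-version) the pairing `Ш²_S(K, M) × Ш¹_S(K, M^D) → ℚ/ℤ` is `(c, z) ↦ α(h_c)(z)` where `h_c` is ANY
preimage of `c` under an obstruction map `Ψ : E → H²(G_S, M^{N_S})` on an auxiliary group `E`
(`E = Hom(N₁, C̄_S)` for a presentation, or `E = Ext¹(A, C̄_S)` on Milne's `Ext` road, I §4 p. 58) and
`α : E → Hom(H¹(G_S, M^D), ℚ/ℤ)` is the duality read of `E` (`inv ∘` Yoneda `∘ nat`).  Everything the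
perfectness proof uses about `(E, α, Ψ)` and the "idèle part" `j : EJ → E` with its local readouts
`R_v : EJ → H¹(K_v, M)` is LINEAR ALGEBRA:
* (R4) `α(j f)(y) = ∑_{v ∈ Σ} inv_v(R_v f ∪ y_v)` (read in `(1/n)ℤ/ℤ`); (R3) every family `(t_v)_{v ∈ Σ}` is
  `(R_v f)_v` for one `f`;
* `Ψ ∘ j = 0`, `ker Ψ ⊆ im j`, `Ψ(E) = Ш²_S(K, M)` (`hΨj`, `hΨker`, `hΨsha`, `hΨsurj`);
* `ker α ⊆ ker Ψ` (`hαΨ`; presentation road: `∂h = ∂h' ⟹ h - h' = ι ≫ q`, killed by `Ψ`; `Ext` road: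
  `α` injective) and `α` ONTO the characters of `H¹(G_S, M^D)` (`hαsurj`; = Tate duality `α¹` bijective
  composed with the bijective bridge `nat`, and `Ext¹(N₂, C̄_S) = 0` on the presentation road).
So this file proves, once, for an ABSTRACT skeleton `(E, EJ, j, α, Ψ, R)`:
* §1 `pairing … : ↥Ш²_S(K, M) →+ ↥Ш¹_S(K, M^D) →+ ℚ/ℤ`, `(c, z) ↦ α(h_c)(z)`, a DEFINITION, with
  `pairing_apply_of_eq` (ANY `Ψ`-preimage gives the value);
* §2 **`pairing_perfect`** — `Ш²_S(K, M)` finite, both adjoints bijective (the readout `e(c) =` `ℤ/n`-lift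
  of `α(h_c)` is additive / injective / surjective modulo `Σ`-local sums; then
  `shaRestricted_tateDual_of_readout`, brick D4c);
* §3 **`pairing_natural`** — for two modules run on skeletons `(E, α, Ψ)`, `(E', α', Ψ')` and ANY map
  `θ : E → E'` transporting a preimage of `c` to a preimage of `x'` (`hΨθ`) and intertwining the duality
  reads at `(z, z')` (`hαθ`): `B'(x', z') = B(c, z)` — clause (N), reduced to two pointwise identities that
  the lane's `Ψ_S` / `nat_S` companion lemmas supply for kernel-monotone adjoint pairs.
The presentation-road file instantiates `E := Hom(N₁, CS)`, `α := adjointMap inv ∘ boundary ∘ nat`.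

HONEST FRAMING: a reduction with displayed hypotheses; no case of Poitou–Tate duality and nothing about
BSD is proved here.  AI formalisation, weaker than expert review; established only by the kernel check.

## References
* J. S. Milne, *Arithmetic Duality Theorems*, 2nd ed. (2006), I Thm. 4.10 (a) and its proof (p. 58),
  I Lemma 4.13, I §0 Prop. 0.19, §4 p. 65. [MilneADT2006]
* D. Harari, *Galois Cohomology and Class Field Theory* (2020), §16.2–16.3, Thm. 17.13 (b), §17.5.
  [Harari2020]
-/

noncomputable section

open Function NumberField IsDedekindDomain
open scoped NumberField

namespace Literature.NumberTheory.GaloisCohomology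

open Literature.NumberTheory.GaloisRepresentations
open Literature.NumberTheory.GaloisRepresentations.DiscreteGaloisModule (TateDual tateDual
  restrictedCohomology restrictedLocalization shaRestricted localTatePairingZMod)
open Literature.AnabelianGeometry.AbsoluteAnabelian.Prop121vii (zmodToQmodZ zmodToQmodZ_injective)

/-! ## §0 `ℚ/ℤ`-valued pairings lifting perfect `ℤ/n`-valued ones -/

section ZModToAddCircle

variable {X Y : Type*} [AddCommGroup X] [AddCommGroup Y] (n : ℕ) [NeZero n]

/-- **A `ℚ/ℤ`-valued pairing on `n`-torsion groups whose values are those of a PERFECT `ℤ/n`-valued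
pairing read in `(1/n)ℤ/ℤ` is perfect** (both adjoints bijective). [cite: MilneADT2006, I §0 Prop. 0.19] -/
theorem bijective_addCircle_pairing_of_zmod_pairing (hX : ∀ x : X, n • x = 0) (hY : ∀ y : Y, n • y = 0)
    (b : X →+ Y →+ ZMod n) (B : X →+ Y →+ AddCircle (1 : ℚ))
    (hbB : ∀ x y, zmodToQmodZ n (b x y) = B x y) (hb : Bijective b) (hb' : Bijective b.flip) :
    Bijective B ∧ Bijective B.flip := by
  have hBx : ∀ x, B x = (zmodToQmodZ n).comp (b x) := fun x => AddMonoidHom.ext fun y => (hbB x y).symm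
  have hBy : ∀ y, B.flip y = (zmodToQmodZ n).comp (b.flip y) := fun y =>
    AddMonoidHom.ext fun x => by rw [AddMonoidHom.flip_apply, AddMonoidHom.comp_apply,
      AddMonoidHom.flip_apply, hbB]
  refine ⟨⟨fun x x' h => hb.1 ?_, fun g => ?_⟩, ⟨fun y y' h => hb'.1 ?_, fun g => ?_⟩⟩
  · apply zmodToQmodZ_comp_injective (Y := Y) n
    change (zmodToQmodZ n).comp (b x) = (zmodToQmodZ n).comp (b x')
    rw [← hBx, ← hBx, h]
  · obtain ⟨g', hg'⟩ := exists_zmodToQmodZ_comp_eq n hY g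
    obtain ⟨x, hx⟩ := hb.2 g'
    exact ⟨x, by rw [hBx, hx, hg']⟩
  · apply zmodToQmodZ_comp_injective (Y := X) n
    change (zmodToQmodZ n).comp (b.flip y) = (zmodToQmodZ n).comp (b.flip y')
    rw [← hBy, ← hBy, h]
  · obtain ⟨g', hg'⟩ := exists_zmodToQmodZ_comp_eq n hX g
    obtain ⟨y, hy⟩ := hb'.2 g'
    exact ⟨y, by rw [hBy, hy, hg']⟩

end ZModToAddCircle

namespace ShaReadout

variable {K : Type} [Field K] [NumberField K] {M : Type} [AddCommGroup M] [TopologicalSpace M]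
  [DiscreteTopology M] [Finite M] {n : ℕ} [NeZero n]
  (ρ : DiscreteGaloisModule K M) (S : Set (HeightOneSpectrum (𝓞 K))) (Sig : Finset (Place K))
  (linv : LocalInvariants K n)
  {E EJ : Type*} [AddCommGroup E] [AddCommGroup EJ] (j : EJ →+ E)
  (α : E →+ (restrictedCohomology (ρ.tateDual n) S 1 →+ AddCircle (1 : ℚ)))
  (Ψ : E →+ restrictedCohomology ρ S 2)
  (R : ∀ v : Place K, EJ →+ galoisCohomology (ρ.toLocal v) 1)

/-! ## §1 The pairing of a readout skeleton -/

omit [NeZero n] in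
/-- **Two `Ψ`-equal elements have duality reads that AGREE ON `Ш¹_S(K, M^D)`**: their difference is `j f`
(`hΨker`), whose read is a `Σ`-local sum ((R4)), which vanishes on a class with zero components at the
places of `Σ`. [cite: MilneADT2006, I Thm. 4.10 (a) (proof, p. 58)] -/
theorem read_eq_of_obstruction_eq [NeZero n]
    (hSig₂ : ∀ v : HeightOneSpectrum (𝓞 K), (Sum.inr v : Place K) ∈ Sig ↔ v ∈ S)
    (hR4 : ∀ (f : EJ) (y : restrictedCohomology (ρ.tateDual n) S 1),
      α (j f) y = zmodToQmodZ n (∑ v ∈ Sig, localTatePairingZMod ρ n v (linv v) (R v f)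
        (restrictedLocalization (ρ.tateDual n) S v 1 y)))
    (hΨker : ∀ h : E, Ψ h = 0 → ∃ f : EJ, h = j f)
    {h h' : E} (hhh' : Ψ h = Ψ h') (z : ↥(shaRestricted (ρ.tateDual n) S 1)) :
    α h z = α h' z := by
  have hd : Ψ (h - h') = 0 := by rw [map_sub, hhh', sub_self]
  obtain ⟨f, hf⟩ := hΨker _ hd
  have hloc : ∀ v ∈ Sig, restrictedLocalization (ρ.tateDual n) S v 1
      (z : restrictedCohomology (ρ.tateDual n) S 1) = 0 := by
    rintro (w | v) hv
    · exact ((DiscreteGaloisModule.mem_shaRestricted_iff _ _ _ _).1 z.2).1 w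
    · exact ((DiscreteGaloisModule.mem_shaRestricted_iff _ _ _ _).1 z.2).2 v ((hSig₂ v).1 hv)
  have key : α (h - h') z = 0 := by
    rw [hf, hR4, Finset.sum_eq_zero fun v hv => ?_, map_zero]
    rw [hloc v hv, map_zero]
  rwa [map_sub, AddMonoidHom.sub_apply, sub_eq_zero] at key

omit [Finite M] [NeZero n] in
/-- A chosen `Ψ`-preimage `h_c ∈ E` of a class `c ∈ Ш²_S(K, M)` (exists by `hΨsurj`; WHICH one is
irrelevant for the pairing, `pairing_apply_of_eq`). [cite: MilneADT2006, I Thm. 4.10 (a) (proof, p. 58)] -/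
def shaLift (hΨsurj : ∀ c ∈ shaRestricted ρ S 2, ∃ h : E, Ψ h = c) (c : ↥(shaRestricted ρ S 2)) : E :=
  (hΨsurj c.1 c.2).choose

omit [Finite M] [NeZero n] in
/-- `Ψ (shaLift c) = c`. [cite: MilneADT2006, I Thm. 4.10 (a) (proof, p. 58)] -/
theorem obstruction_shaLift (hΨsurj : ∀ c ∈ shaRestricted ρ S 2, ∃ h : E, Ψ h = c)
    (c : ↥(shaRestricted ρ S 2)) : Ψ (shaLift ρ S Ψ hΨsurj c) = c :=
  (hΨsurj c.1 c.2).choose_spec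

/-- **THE PAIRING `Ш²_S(K, M) × Ш¹_S(K, M^D) → ℚ/ℤ` of a readout skeleton**, `(c, z) ↦ α(h_c)(z)` for a
`Ψ`-preimage `h_c` of `c` — ONE bi-additive map determined by `(α, Ψ)` (additivity in `c`: the preimages of
`c + c'` and `h_c + h_{c'}` are `Ψ`-equal, `read_eq_of_obstruction_eq`).  Milne I Thm. 4.10 (a)'s pairing in
the form the duality roads construct it. [cite: MilneADT2006, I Thm. 4.10 (a) (proof, p. 58)]
[cite: Harari2020, §17.5 (proof of Thm. 17.13 (b), p. 302)] -/
def pairing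
    (hSig₂ : ∀ v : HeightOneSpectrum (𝓞 K), (Sum.inr v : Place K) ∈ Sig ↔ v ∈ S)
    (hR4 : ∀ (f : EJ) (y : restrictedCohomology (ρ.tateDual n) S 1),
      α (j f) y = zmodToQmodZ n (∑ v ∈ Sig, localTatePairingZMod ρ n v (linv v) (R v f)
        (restrictedLocalization (ρ.tateDual n) S v 1 y)))
    (hΨker : ∀ h : E, Ψ h = 0 → ∃ f : EJ, h = j f)
    (hΨsurj : ∀ c ∈ shaRestricted ρ S 2, ∃ h : E, Ψ h = c) :
    ↥(shaRestricted ρ S 2) →+ ↥(shaRestricted (ρ.tateDual n) S 1) →+ AddCircle (1 : ℚ) where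
  toFun c := (α (shaLift ρ S Ψ hΨsurj c)).comp (shaRestricted (ρ.tateDual n) S 1).subtype
  map_zero' := by
    refine AddMonoidHom.ext fun z => ?_
    simp only [AddMonoidHom.comp_apply, AddSubgroup.coe_subtype, AddMonoidHom.zero_apply]
    rw [read_eq_of_obstruction_eq ρ S Sig linv j α Ψ R hSig₂ hR4 hΨker (h' := 0)
        (by rw [obstruction_shaLift, map_zero]; rfl) z, map_zero, AddMonoidHom.zero_apply]
  map_add' c c' := by
    refine AddMonoidHom.ext fun z => ?_
    simp only [AddMonoidHom.comp_apply, AddSubgroup.coe_subtype, AddMonoidHom.add_apply]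
    rw [read_eq_of_obstruction_eq ρ S Sig linv j α Ψ R hSig₂ hR4 hΨker
        (h' := shaLift ρ S Ψ hΨsurj c + shaLift ρ S Ψ hΨsurj c')
        (by rw [map_add, obstruction_shaLift, obstruction_shaLift, obstruction_shaLift]; rfl) z,
      map_add, AddMonoidHom.add_apply]

/-- **The value does not depend on the preimage**: `pairing c z = α h z` for EVERY `h` with `Ψ h = c`.
[cite: MilneADT2006, I Thm. 4.10 (a) (proof, p. 58)] -/
theorem pairing_apply_of_eq
    (hSig₂ : ∀ v : HeightOneSpectrum (𝓞 K), (Sum.inr v : Place K) ∈ Sig ↔ v ∈ S)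
    (hR4 : ∀ (f : EJ) (y : restrictedCohomology (ρ.tateDual n) S 1),
      α (j f) y = zmodToQmodZ n (∑ v ∈ Sig, localTatePairingZMod ρ n v (linv v) (R v f)
        (restrictedLocalization (ρ.tateDual n) S v 1 y)))
    (hΨker : ∀ h : E, Ψ h = 0 → ∃ f : EJ, h = j f)
    (hΨsurj : ∀ c ∈ shaRestricted ρ S 2, ∃ h : E, Ψ h = c)
    (c : ↥(shaRestricted ρ S 2)) {h : E} (hh : Ψ h = c) (z : ↥(shaRestricted (ρ.tateDual n) S 1)) :
    pairing ρ S Sig linv j α Ψ R hSig₂ hR4 hΨker hΨsurj c z = α h z := by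
  change α (shaLift ρ S Ψ hΨsurj c) z = _
  exact read_eq_of_obstruction_eq ρ S Sig linv j α Ψ R hSig₂ hR4 hΨker (h' := h)
    (by rw [obstruction_shaLift, hh]) z

/-! ## §2 Perfectness -/

/-- **Milne I Thm. 4.10 (a) for `G_S`, `S` finite, ON THE DEFINED PAIRING of a readout skeleton**:
`Ш²_S(K, M)` is finite and both adjoints of `pairing` are bijective.  Hypotheses, all displayed:
`Σ = S ∪ Ω_∞` as `Sig`; local invariant maps perfect at the finite places and representable at the
infinite ones; `Ш¹_S(K, M^D)` finite; (R3) on `Σ`, (R4); `Ψ ∘ j = 0`, `ker Ψ ⊆ im j`, `Ψ(E) = Ш²_S`;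
`ker α ⊆ ker Ψ` and `α` onto the characters of `H¹(G_S, M^D)`.  Proof: the `ℤ/n`-valued readout
`e(c) = ` lift of `α(h_c)` is additive / injective / surjective modulo `Σ`-local sums;
`shaRestricted_tateDual_of_readout` makes `(c, y) ↦ e(c)(y)` perfect; §0 transports.
[cite: MilneADT2006, I Thm. 4.10 (a) (proof, p. 58), Lemma 4.13] [cite: Harari2020, Thm. 17.13 (b) and §17.5] -/
theorem pairing_perfect (hM : ∀ m : M, n • m = 0)
    (hSig₁ : ∀ w : InfinitePlace K, (Sum.inl w : Place K) ∈ Sig)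
    (hSig₂ : ∀ v : HeightOneSpectrum (𝓞 K), (Sum.inr v : Place K) ∈ Sig ↔ v ∈ S)
    (hperf : linv.IsPerfect)
    (harch : ∀ (w : InfinitePlace K) (Φ : galoisCohomology ((ρ.tateDual n).toLocal (Sum.inl w)) 1 →+ ZMod n),
      ∃ t : galoisCohomology (ρ.toLocal (Sum.inl w)) 1,
        ∀ x, Φ x = localTatePairingZMod ρ n (Sum.inl w) (linv (Sum.inl w)) t x)
    [Finite ↥(shaRestricted (ρ.tateDual n) S 1)]
    (hR3 : ∀ t : Π v : Place K, galoisCohomology (ρ.toLocal v) 1, ∃ f : EJ, ∀ v ∈ Sig, R v f = t v)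
    (hR4 : ∀ (f : EJ) (y : restrictedCohomology (ρ.tateDual n) S 1),
      α (j f) y = zmodToQmodZ n (∑ v ∈ Sig, localTatePairingZMod ρ n v (linv v) (R v f)
        (restrictedLocalization (ρ.tateDual n) S v 1 y)))
    (hΨj : ∀ f : EJ, Ψ (j f) = 0)
    (hΨker : ∀ h : E, Ψ h = 0 → ∃ f : EJ, h = j f)
    (hΨsha : ∀ h : E, Ψ h ∈ shaRestricted ρ S 2)
    (hΨsurj : ∀ c ∈ shaRestricted ρ S 2, ∃ h : E, Ψ h = c)
    (hαΨ : ∀ h h' : E, α h = α h' → Ψ h = Ψ h')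
    (hαsurj : Surjective α) :
    Finite ↥(shaRestricted ρ S 2) ∧
      Bijective (pairing ρ S Sig linv j α Ψ R hSig₂ hR4 hΨker hΨsurj) ∧
      Bijective (pairing ρ S Sig linv j α Ψ R hSig₂ hR4 hΨker hΨsurj).flip := by
  classical
  let B := pairing ρ S Sig linv j α Ψ R hSig₂ hR4 hΨker hΨsurj
  let lift := shaLift ρ S Ψ hΨsurj
  have hlift : ∀ c : ↥(shaRestricted ρ S 2), Ψ (lift c) = c := obstruction_shaLift ρ S Ψ hΨsurj
  -- `H¹(G_S, M^D)` is `n`-torsion; the `ℤ/n`-valued lift `eh h` of `α h`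
  have hN1 : ∀ y : restrictedCohomology (ρ.tateDual n) S 1, n • y = 0 :=
    fun y => nsmul_restrictedCohomology_tateDual_eq_zero ρ S n 1 y
  have hfac : ∀ h : E, ∃ φ : restrictedCohomology (ρ.tateDual n) S 1 →+ ZMod n,
      ∀ y, zmodToQmodZ n (φ y) = α h y := fun h => by
    obtain ⟨φ, hφ⟩ := exists_zmodToQmodZ_comp_eq n hN1 (α h)
    exact ⟨φ, fun y => DFunLike.congr_fun hφ y⟩
  choose eh heh using hfac
  have heh_sub : ∀ (h h' : E) (y : restrictedCohomology (ρ.tateDual n) S 1),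
      eh (h - h') y = eh h y - eh h' y := fun h h' y => by
    apply zmodToQmodZ_injective n
    rw [map_sub, heh, heh, heh, map_sub, AddMonoidHom.sub_apply]
  -- THE READOUT
  let e : ↥(shaRestricted ρ S 2) → (restrictedCohomology (ρ.tateDual n) S 1 →+ ZMod n) := fun c => eh (lift c)
  have he : ∀ c, e c = eh (lift c) := fun _ => rfl
  have hloc : ∀ (f : EJ) (y : restrictedCohomology (ρ.tateDual n) S 1),
      eh (j f) y = ∑ v ∈ Sig, localTatePairingZMod ρ n v (linv v) (R v f)
        (restrictedLocalization (ρ.tateDual n) S v 1 y) := fun f y => by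
    apply zmodToQmodZ_injective n
    rw [heh, hR4]
  have hΨ_eq_of_eh : ∀ h h' : E, eh h = eh h' → Ψ h = Ψ h' := fun h h' hhh' =>
    hαΨ h h' (AddMonoidHom.ext fun y => by rw [← heh, ← heh, hhh'])
  -- (add)
  have hadd : ∀ c c' : ↥(shaRestricted ρ S 2), ∃ t : Π v : Place K, galoisCohomology (ρ.toLocal v) 1,
      ∀ y : restrictedCohomology (ρ.tateDual n) S 1,
        (e (c + c') - e c - e c') y = ∑ v ∈ Sig, localTatePairingZMod ρ n v (linv v) (t v)
          (restrictedLocalization (ρ.tateDual n) S v 1 y) := by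
    intro c c'
    set d : E := lift (c + c') - lift c - lift c' with hd
    have hΨd : Ψ d = 0 := by
      rw [hd, map_sub, map_sub, hlift, hlift, hlift, AddSubgroup.coe_add, add_sub_cancel_left, sub_self]
    obtain ⟨f, hf⟩ := hΨker d hΨd
    refine ⟨fun v => R v f, fun y => ?_⟩
    rw [AddMonoidHom.sub_apply, AddMonoidHom.sub_apply, he, he, he, ← heh_sub, ← heh_sub, ← hd, hf]
    exact hloc f y
  -- (inj)
  have hinj : ∀ c : ↥(shaRestricted ρ S 2), (∃ t : Π v : Place K, galoisCohomology (ρ.toLocal v) 1,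
      ∀ y : restrictedCohomology (ρ.tateDual n) S 1,
        e c y = ∑ v ∈ Sig, localTatePairingZMod ρ n v (linv v) (t v)
          (restrictedLocalization (ρ.tateDual n) S v 1 y)) → c = 0 := by
    rintro c ⟨t, hct⟩
    obtain ⟨f, hf⟩ := hR3 t
    have hfun : eh (lift c) = eh (j f) := by
      ext y
      rw [← he, hct y, hloc f y]
      exact Finset.sum_congr rfl fun v hv => by rw [hf v hv]
    have hΨ := hΨ_eq_of_eh _ _ hfun
    rw [hlift, hΨj] at hΨ
    exact Subtype.ext hΨ
  -- (surj)
  have hsurj : ∀ φ : restrictedCohomology (ρ.tateDual n) S 1 →+ ZMod n, ∃ (c : ↥(shaRestricted ρ S 2))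
      (t : Π v : Place K, galoisCohomology (ρ.toLocal v) 1),
      ∀ y : restrictedCohomology (ρ.tateDual n) S 1,
        (φ - e c) y = ∑ v ∈ Sig, localTatePairingZMod ρ n v (linv v) (t v)
          (restrictedLocalization (ρ.tateDual n) S v 1 y) := by
    intro φ
    obtain ⟨h, hh⟩ := hαsurj ((zmodToQmodZ n).comp φ)
    have hEHh : ∀ y, α h y = zmodToQmodZ n (φ y) := fun y => by rw [hh]; rfl
    let c : ↥(shaRestricted ρ S 2) := ⟨Ψ h, hΨsha h⟩
    have hΨd : Ψ (lift c - h) = 0 := by rw [map_sub, hlift, sub_self]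
    obtain ⟨f, hf⟩ := hΨker _ hΨd
    refine ⟨c, fun v => R v (-f), fun y => ?_⟩
    have hneg : h - lift c = j (-f) := by rw [← neg_sub, hf, map_neg]
    have key : eh (h - lift c) y = eh (j (-f)) y := DFunLike.congr_fun (congrArg eh hneg) y
    rw [← hloc (-f) y, ← key, heh_sub, AddMonoidHom.sub_apply, he]
    congr 1
    apply zmodToQmodZ_injective n
    rw [heh, hEHh]
  -- the perfect `ℤ/n`-valued pairing, transported to `pairing`
  obtain ⟨hfin, b, hb, hbij, hbij'⟩ :=
    shaRestricted_tateDual_of_readout ρ hM S Sig hSig₁ hSig₂ hperf harch e hadd hinj hsurj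
  have hshaN : ∀ y : ↥(shaRestricted (ρ.tateDual n) S 1), n • y = 0 :=
    fun y => nsmul_shaRestricted_tateDual_eq_zero ρ S n 1 y
  have hshaTwoN : ∀ c : ↥(shaRestricted ρ S 2), n • c = 0 := fun c => Subtype.ext (by
    rw [AddSubgroupClass.coe_nsmul, AddSubgroup.coe_zero]
    exact ContinuousRep.nsmul_eq_zero_of_forall _ n (fun v => Subtype.ext (by
      rw [Submodule.coe_smul, natCast_zsmul, hM, Submodule.coe_zero])) 2 _)
  have hbB : ∀ (c : ↥(shaRestricted ρ S 2)) (y : ↥(shaRestricted (ρ.tateDual n) S 1)),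
      zmodToQmodZ n (b c y) = B c y := fun c y => by
    rw [hb, he, heh]
    rfl
  exact ⟨hfin, bijective_addCircle_pairing_of_zmod_pairing n hshaTwoN hshaN b B hbB hbij hbij'⟩

/-! ## §3 Naturality -/

/-- **Naturality of the skeleton pairing in the module** (clause (N) of Milne I Thm. 4.10 (a) /
`poitouTate_shaRestricted_tateDual_natural(_at)`, SKELETON form).  Two modules `M` (level `n`) and
`M'` (level `n'`) with readout skeletons `(E, j, α, Ψ)` and `(E', j', α', Ψ')`, and ANY function
`θ : E → E'` that (i) sends a `Ψ`-preimage of `c ∈ Ш²_S(K, M)` to a `Ψ'`-preimage of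
`x' ∈ Ш²_S(K, M')` (`hΨθ` — "`x' = F_* c`" read through the obstruction maps) and (ii) intertwines the
duality reads at `(z, z')` (`hαθ` — "`z = G_* z'`" read through `α`, `α'`): then `B'(x', z') = B(c, z)`.
On the presentation road `θ = (φ₁ ≫ ·)` for a morphism `φ` of presentations and (ii) is the naturality of
`∂`, of the Yoneda pairing and of `nat`; on the `Ext` road `θ = φ^*`.
[cite: MilneADT2006, I Thm. 4.10 (a) and §4 p. 65] [cite: Harari2020, §16.2 (16.4)] -/
theorem pairing_natural
    {M' : Type} [AddCommGroup M'] [TopologicalSpace M'] [DiscreteTopology M'] [Finite M'] {n' : ℕ} [NeZero n']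
    (ρ' : DiscreteGaloisModule K M') (linv' : LocalInvariants K n')
    {E' EJ' : Type*} [AddCommGroup E'] [AddCommGroup EJ'] (j' : EJ' →+ E')
    (α' : E' →+ (restrictedCohomology (ρ'.tateDual n') S 1 →+ AddCircle (1 : ℚ)))
    (Ψ' : E' →+ restrictedCohomology ρ' S 2)
    (R' : ∀ v : Place K, EJ' →+ galoisCohomology (ρ'.toLocal v) 1)
    (hSig₂ : ∀ v : HeightOneSpectrum (𝓞 K), (Sum.inr v : Place K) ∈ Sig ↔ v ∈ S)
    (hR4 : ∀ (f : EJ) (y : restrictedCohomology (ρ.tateDual n) S 1),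
      α (j f) y = zmodToQmodZ n (∑ v ∈ Sig, localTatePairingZMod ρ n v (linv v) (R v f)
        (restrictedLocalization (ρ.tateDual n) S v 1 y)))
    (hΨker : ∀ h : E, Ψ h = 0 → ∃ f : EJ, h = j f)
    (hΨsurj : ∀ c ∈ shaRestricted ρ S 2, ∃ h : E, Ψ h = c)
    (hR4' : ∀ (f : EJ') (y : restrictedCohomology (ρ'.tateDual n') S 1),
      α' (j' f) y = zmodToQmodZ n' (∑ v ∈ Sig, localTatePairingZMod ρ' n' v (linv' v) (R' v f)
        (restrictedLocalization (ρ'.tateDual n') S v 1 y)))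
    (hΨker' : ∀ h : E', Ψ' h = 0 → ∃ f : EJ', h = j' f)
    (hΨsurj' : ∀ c ∈ shaRestricted ρ' S 2, ∃ h : E', Ψ' h = c)
    (θ : E → E') (c : ↥(shaRestricted ρ S 2)) (x' : ↥(shaRestricted ρ' S 2))
    (z' : ↥(shaRestricted (ρ'.tateDual n') S 1)) (z : ↥(shaRestricted (ρ.tateDual n) S 1))
    (hΨθ : ∀ h : E, Ψ h = c → Ψ' (θ h) = x')
    (hαθ : ∀ h : E, Ψ h = c → α' (θ h) z' = α h z) :
    pairing ρ' S Sig linv' j' α' Ψ' R' hSig₂ hR4' hΨker' hΨsurj' x' z' =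
      pairing ρ S Sig linv j α Ψ R hSig₂ hR4 hΨker hΨsurj c z := by
  obtain ⟨h, hh⟩ := hΨsurj c.1 c.2
  rw [pairing_apply_of_eq ρ' S Sig linv' j' α' Ψ' R' hSig₂ hR4' hΨker' hΨsurj' x' (hΨθ h hh) z',
    pairing_apply_of_eq ρ S Sig linv j α Ψ R hSig₂ hR4 hΨker hΨsurj c hh z, hαθ h hh]

end ShaReadout

end Literature.NumberTheory.GaloisCohomology

end
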